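import Summits.BirchSwinnertonDyer.BirchSwinnertonDyer.Theorems.ManinLocalTwoThreeNegOneTwistConductorFourMulHolds
import HarnessLib

/-!
# A quadratic twist UNRAMIFIED at an odd place does not move the conductor exponent there: `f_v(V ⊗ d) = f_v(V)` for `v ∤ 2d`
# (route `ManinLocalTwoThree`, cell bsd-f2-manin; support lemma for the C3 coprime-partner transport; LEAD seat p1 gen 13)

THE POINT.  p2's `conductorExponent_quadraticTwist_negOne_eq_of_ne_two` (p696508) proves `f_v(V ⊗ (−1)) = f_v(V)` at every `v ∤ 2` by writing
`−1 = 4k + 1` with `|k|_v ≤ 1` and using `V ⊗ (4k+1) ≅ V.twistModel k` (`exists_variableChange_twistModel_eq_quadraticTwist`) +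
`conductorExponent_twistModel` + `conductorExponent_smul'`.  The same proof works VERBATIM for any integer `d` prime to `v` at an odd place `v`
(`k = (d − 1)/4`, `|4|_v = 1`, `|d|_v = 1`): **`conductorExponent_quadraticTwist_eq_of_not_dvd`**.  Consumers: the C3 line's coprime twist partners
(`q* = ±q`, `q ≠ 2, 3`: the 3-adic conductor exponent, hence «`W ⊗ (−3)` additive at 3», is the same for `W` and `W ⊗ q*` — the transport p2's C3 core
binders need along the orbit-minimal descent, my 08:0xZ STATUS note), and dually the C2 core along ternary/coprime twists at `v = 2`… (not: `v = 2` is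
excluded here; at `2` the dyadic twists DO move `f₂`, Barrios et al.).  Corollaries: `conductorExponent_quadraticTwist_primeStar_eq_three` (`v = 3`, twist by
`q* = (−1)^{(q−1)/2} q`, `q ≠ 3` odd prime) and the additive-at-3 transport `hasAdditiveReductionAt_three_iff_quadraticTwist_of_not_dvd`-shaped statement via
the conductor exponent (`2 ≤ f₃`).

HONEST FRAMING.  Elementary local lemma; nothing about C2/C3, Manin's conjecture or BSD is proved.  No definitions, no sorry.
-/

set_option autoImplicit false
-- lint-debt: the directory name repeats the summit name (sibling precedent `ManinLocalTwoThreeNegOneTwistConductorFourMulHolds.lean`)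
set_option linter.dupNamespace false

noncomputable section

open scoped Classical
open WeierstrassCurve IsDedekindDomain IsDedekindDomain.HeightOneSpectrum Rat.HeightOneSpectrum
  Literature.NumberTheory.DiophantineGeometry Literature.NumberTheory.EllipticCurves

namespace Summit.BirchSwinnertonDyer.BirchSwinnertonDyer.Theorems.ManinLocalTwoThree

/-- **`f_v(V ⊗ d) = f_v(V)` at every place `v` with `v ∤ 2` and `v ∤ d`** (`d ∈ ℤ`): the twist by a `v`-adic unit at an odd place is unramified there.
Proof = p2's `d = −1` argument with `k = (d−1)/4`. [cite: SilvermanATAEC1994, IV.9.4 (PDF pp. 344–346)] -/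
theorem conductorExponent_quadraticTwist_eq_of_not_dvd (V : WeierstrassCurve ℚ) [V.IsElliptic] (v : HeightOneSpectrum ℤ)
    (hv : natGenerator v ≠ 2) (d : ℤ) (hd : ¬ (natGenerator v : ℤ) ∣ d) :
    (V.quadraticTwist (d : ℚ)).conductorExponent v = V.conductorExponent v := by
  have hgen : (natGenerator v).Prime := prime_natGenerator v
  have hdZ0 : d ≠ 0 := by rintro rfl; exact hd (dvd_zero _)
  have hd0 : (d : ℚ) ≠ 0 := by exact_mod_cast hdZ0
  -- `|d|_v = 1`
  have hdv : v.valuation ℚ (d : ℚ) = 1 := by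
    rw [Literature.NumberTheory.EllipticCurves.Rat.valuation_intCast_eq_one_iff]
    exact hd
  -- `|4|_v = 1`
  have h4v : v.valuation ℚ (4 : ℚ) = 1 := by
    rw [show (4 : ℚ) = ((4 : ℤ) : ℚ) by norm_num, Literature.NumberTheory.EllipticCurves.Rat.valuation_intCast_eq_one_iff]
    intro h
    have h2 : (natGenerator v : ℤ) ∣ 2 ^ 2 := by simpa using h
    have h2' : (natGenerator v : ℤ) ∣ 2 := (Nat.prime_iff_prime_int.mp hgen).dvd_of_dvd_pow h2
    have h2'' : natGenerator v ∣ 2 := by exact_mod_cast h2'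
    exact hv ((Nat.prime_dvd_prime_iff_eq hgen Nat.prime_two).mp h2'')
  set k : ℚ := ((d : ℚ) - 1) / 4 with hk_def
  have hk4 : 4 * k + 1 = (d : ℚ) := by rw [hk_def]; ring
  have hkv : v.valuation ℚ k ≤ 1 := by
    rw [hk_def, map_div₀, h4v, div_one,
      show ((d : ℚ) - 1) = algebraMap ℤ ℚ (d - 1) by rw [eq_intCast]; push_cast; ring]
    exact HeightOneSpectrum.valuation_le_one v (d - 1)
  have hk1 : v.valuation ℚ (4 * k + 1) = 1 := by rw [hk4]; exact hdv
  obtain ⟨C₁, -, hC₁⟩ := exists_variableChange_twistModel_eq_quadraticTwist V k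
  rw [hk4] at hC₁
  haveI : (V.twistModel k).IsElliptic := by
    refine ⟨?_⟩
    rw [twistModel_Δ, hk4]
    exact (IsUnit.mk0 _ (pow_ne_zero 6 hd0)).mul V.isUnit_Δ
  haveI : (V.quadraticTwist (d : ℚ)).IsElliptic := V.isElliptic_quadraticTwist hd0
  rw [← hC₁, conductorExponent_smul']
  exact conductorExponent_twistModel v V hkv hk1

/-- **At `v = 3`: the twist by an integer prime to `3` does not move `f₃`.** [cite: SilvermanATAEC1994, IV.9.4 (PDF pp. 344–346)] -/
theorem conductorExponent_three_quadraticTwist_eq_of_not_three_dvd (V : WeierstrassCurve ℚ) [V.IsElliptic] (d : ℤ) (hd : ¬ (3 : ℤ) ∣ d) :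
    (V.quadraticTwist (d : ℚ)).conductorExponent ((primesEquiv (R := ℤ)).symm ⟨3, Nat.prime_three⟩) =
      V.conductorExponent ((primesEquiv (R := ℤ)).symm ⟨3, Nat.prime_three⟩) := by
  have hv : natGenerator ((primesEquiv (R := ℤ)).symm ⟨3, Nat.prime_three⟩) = 3 :=
    congrArg Subtype.val ((primesEquiv (R := ℤ)).apply_symm_apply ⟨3, Nat.prime_three⟩)
  refine conductorExponent_quadraticTwist_eq_of_not_dvd V _ (by rw [hv]; norm_num) d ?_
  rw [hv]; exact_mod_cast hd

/-- **The composite twist at `3`: `f₃((V ⊗ d) ⊗ (−3)) = f₃(V ⊗ (−3))` for `3 ∤ d`** — so «`W ⊗ (−3)` additive at 3» (p2's third C3-core binder, read as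
`2 ≤ f₃`) passes between a curve and its twists by integers prime to `3` (e.g. the coprime partners `q* = ±q`, `q ≠ 3`).
[cite: SilvermanATAEC1994, IV.9.4 (PDF pp. 344–346)] -/
theorem conductorExponent_three_quadraticTwist_quadraticTwist_negThree_eq_of_not_three_dvd (V : WeierstrassCurve ℚ) [V.IsElliptic]
    (d : ℤ) (hd : ¬ (3 : ℤ) ∣ d) :
    (haveI := V.isElliptic_quadraticTwist (show ((-3 : ℤ) : ℚ) ≠ 0 by norm_num);
      ((V.quadraticTwist ((-3 : ℤ) : ℚ)).quadraticTwist (d : ℚ)).conductorExponent ((primesEquiv (R := ℤ)).symm ⟨3, Nat.prime_three⟩)) =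
      (V.quadraticTwist ((-3 : ℤ) : ℚ)).conductorExponent ((primesEquiv (R := ℤ)).symm ⟨3, Nat.prime_three⟩) := by
  haveI := V.isElliptic_quadraticTwist (show ((-3 : ℤ) : ℚ) ≠ 0 by norm_num)
  exact conductorExponent_three_quadraticTwist_eq_of_not_three_dvd (V.quadraticTwist ((-3 : ℤ) : ℚ)) d hd

/-- **Twists commute into the ternary twist: `(V ⊗ d) ⊗ (−3) = (V ⊗ (−3)) ⊗ d`** (both are `V ⊗ (−3d)`, `quadraticTwist_quadraticTwist`). [folklore] -/
theorem quadraticTwist_negThree_comm (V : WeierstrassCurve ℚ) (d : ℚ) :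
    (V.quadraticTwist d).quadraticTwist ((-3 : ℤ) : ℚ) = (V.quadraticTwist ((-3 : ℤ) : ℚ)).quadraticTwist d := by
  rw [WeierstrassCurve.quadraticTwist_quadraticTwist, WeierstrassCurve.quadraticTwist_quadraticTwist, mul_comm]

end Summit.BirchSwinnertonDyer.BirchSwinnertonDyer.Theorems.ManinLocalTwoThree

end
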